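import Mathlib
import Summits.ResolutionOfSingularities.ResolutionOfSingularities.Theorems.RadicialJungCleanModelsCleanLU3CompositeMonoDim
import Summits.ResolutionOfSingularities.ResolutionOfSingularities.Theorems.RadicialJungCleanModelsCleanLU3CompositeFrame
import Literature.AlgebraicGeometry.Resolution.QuadraticTransformsFactorization
import Literature.AlgebraicGeometry.Resolution.FormalBranchDescent
import HarnessLib

/-!
# Route `RadicialJung`, crux `CleanModels` (stmt-15917), stub `stub_cleanLU3DefectNonDiscrete`, sub-line (C-div): MONO — a fixed element
# of the residue surface becomes unit × monomial at some later stage of the quadratic sequence along `Ō`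

Line `Sketch` rev 24 of crux stmt-ResolutionOfSingularities-15917; lead `res-B-lead-1` g4 (workfile `Lines/Sketch_Cdiv_assembly.lean` v2,
piece MONO).  OURS; nothing here proves resolution in characteristic `p`.

`exists_stage_monomial`: let `κ/k` be a field, `Ō` a valuation ring of `κ`, `Ā ⊆ Ō` a finitely generated `k`-model with `Frac Ā = κ`, all
centres of `Ō` above `Ā` closed, and `R̄ : ℕ → Subring κ` the quadratic sequence along `Ō` starting at the regular two-dimensional
`R̄₀ = locAtCentre Ā Ō` (each `R̄ₙ` regular of dimension `2` and the local ring of a finitely generated model, ✓ `exists_quadraticSeq_package`).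
For every stage `N` and every non-zero `d ∈ R̄_N` there is a later stage `M ≥ N` with a regular system of parameters `(z₁, z₂)` of `R̄_M` in
which `d = ε z₁^γ z₂^δ`, `ε` a unit.  PROOF: monomialize `d` at `R̄_N` along `Ō` (✓ `exists_localRing_monomial_of_embeddedResolution_dim`, `n = 1`,
mod embedded resolution of surfaces `hEmb`), realise the resulting regular local ring inside `κ` as the local ring of a finitely generated
model (pattern of ✓ `exists_frame_of_coarsening`), and identify it with some `R̄_M` by Abhyankar's factorization
(✓ `AbhyankarQuadraticFactorization.exists_eq_of_dominated`).
-/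

noncomputable section

set_option linter.dupNamespace false -- mandated namespace of this single-conjunct summit

open IsLocalRing AlgebraicGeometry CategoryTheory
open Literature.AlgebraicGeometry.Resolution

namespace Summit.ResolutionOfSingularities.ResolutionOfSingularities.Theorems.RadicialJung.CleanModels

variable {κ : Type} [Field κ] {k : Type} [Field k] [Algebra k κ]

/-- **MONO.**  See the module docstring. [cite: CossartJannsenSaito2020, Cor. 1.5, p. 7] -/
theorem exists_stage_monomial
    (hEmb : ∀ (Z : Scheme.{0}) [IsIntegral Z] [IsNoetherian Z], Scheme.IsRegular Z →
      Scheme.IsExcellent Z → ∀ (X : Set Z), IsClosed X → X ≠ Set.univ → topologicalKrullDim X ≤ 2 →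
        ∃ (Z' : Scheme.{0}) (π : Z' ⟶ Z), IsProper π ∧ Function.Surjective π.base ∧
          (∃ U : Z.Opens, (U : Set Z) = Xᶜ ∧ IsIso (π ∣_ U)) ∧
          IsStrictNormalCrossingsDivisor Z' (π.base ⁻¹' X))
    (Ō : ValuationSubring κ) (Ā : Subalgebra k κ) (hĀŌ : Ā.toSubring ≤ Ō.toSubring) (hĀfg : Ā.FG)
    [IsFractionRing Ā κ]
    (hzd : ∀ (T : Subring κ) (hT : T ≤ Ō.toSubring), Ā.toSubring ≤ T → (subringCentre T Ō hT).IsMaximal)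
    (hdim2 : ringKrullDim (locAtCentre Ā.toSubring Ō) = 2)
    (Rb : ℕ → Subring κ) (hR0 : Rb 0 = locAtCentre Ā.toSubring Ō)
    (hstep : ∀ i, IsQuadraticTransformAlong Ō (Rb i) (Rb (i + 1)))
    (hregR : ∀ i, IsRegularLocalRing (Rb i)) (hdimR : ∀ i, ringKrullDim (Rb i) = 2)
    (hmodel : ∀ i, ∃ Āi : Subalgebra k κ, Āi.toSubring ≤ Ō.toSubring ∧ Ā ≤ Āi ∧ Āi.FG ∧ Rb i = locAtCentre Āi.toSubring Ō)
    (N : ℕ) (d : κ) (hd : d ∈ Rb N) (hd0 : d ≠ 0) :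
    ∃ (M : ℕ), N ≤ M ∧ ∃ (z₁ z₂ ε : Rb M) (γ δ : ℕ), IsUnit ε ∧
      (haveI := (hregR M).toIsLocalRing; maximalIdeal (Rb M)) = Ideal.span {z₁, z₂} ∧
      d = (ε : κ) * (z₁ : κ) ^ γ * (z₂ : κ) ^ δ := by
  classical
  obtain ⟨ĀN, hĀNŌ, hĀĀN, hĀNfg, hRN⟩ := hmodel N
  haveI hregN := hregR N
  have hmono := sequence_monotone hstep
  have hdomseq := fun n => (sequence_dominates (R := Rb) (hR0 ▸ subringDominates_locAtCentre hĀŌ) hstep n)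
  -- dimension of `Ā`
  have hdimĀ : ringKrullDim Ā = 2 := by
    rw [← ringKrullDim_locAtCentre_eq_of_isMaximal Ā hĀfg Ō hĀŌ (hzd _ hĀŌ le_rfl)]; exact hdim2
  by_cases hvd : Ō.valuation d = 1
  · -- `d` is a unit of `R̄_N`: take `M = N` and any regular system of parameters
    have hd2 : (maximalIdeal (Rb N)).spanFinrank = 2 := by
      have h := hregN.spanFinrank_maximalIdeal
      rw [hdimR N] at h
      exact_mod_cast h
    obtain ⟨x, hx⟩ := exists_regularSystemOfParameters (R := Rb N)
    let x' : Fin 2 → Rb N := fun i => x (Fin.cast hd2.symm i)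
    have hx' : Ideal.span (Set.range x') = maximalIdeal (Rb N) := by
      rw [← hx]
      congr 1
      ext y
      simp only [Set.mem_range, x']
      constructor
      · rintro ⟨i, rfl⟩; exact ⟨_, rfl⟩
      · rintro ⟨i, rfl⟩; exact ⟨Fin.cast hd2 i, congrArg x (Fin.ext rfl)⟩
    refine ⟨N, le_rfl, x' 0, x' 1, ⟨d, hd⟩, 0, 0, ?_, ?_, by simp⟩
    · -- a unit: `v̄ d = 1` and `R̄_N` is dominated by `Ō`
      by_contra hnu
      have hm : (⟨d, hd⟩ : Rb N) ∈ maximalIdeal (Rb N) := hnu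
      rw [(subringDominates_valuationSubring_iff (hdomseq N).1.1).mp (hdomseq N).1] at hm
      change Ō.valuation d < 1 at hm
      rw [hvd] at hm; exact lt_irrefl _ hm
    · rw [← hx', ideal_span_range_fin_two]
  · -- `d ∈ 𝔪(R̄_N)`: monomialize along `Ō`
    have hSO : Rb N ≤ Ō.toSubring := (hdomseq N).1.1
    have hdom : SubringDominates (Rb N) Ō.toSubring := (hdomseq N).1
    have hSm : ∀ r : (Rb N), r ∈ maximalIdeal (Rb N) ↔ Ō.valuation (r : κ) < 1 := (subringDominates_valuationSubring_iff hSO).mp hdom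
    have hvd' : Ō.valuation d < 1 := lt_of_le_of_ne ((Ō.valuation_le_one_iff _).mpr (hSO hd)) hvd
    -- `(Rb N)` is excellent: a localisation of a finitely generated `k`-algebra
    haveI : Algebra.FiniteType k ĀN := (Subalgebra.fg_iff_finiteType ĀN).mp hĀNfg
    have hexcA : IsExcellentRing ĀN := isExcellentRing_of_finiteType_field k ĀN
    haveI := isLocalization_locAtCentre (K := κ) (O := Ō) hĀNŌ
    have hexcS : IsExcellentRing (Rb N) := by
      rw [hRN]
      exact IsExcellentRing.of_isLocalization (A := ĀN.toSubring) (B := locAtCentre ĀN.toSubring Ō)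
        (subringCentre ĀN.toSubring Ō hĀNŌ).primeCompl hexcA
    have hdimS : ringKrullDim (Rb N) = (1 + 1 : ℕ) := by rw [hdimR N]; rfl
    have hRO : ∀ r : (Rb N), algebraMap (Rb N) κ r ∈ Ō := fun r => hSO r.2
    have hRm : ∀ r : (Rb N), r ∈ maximalIdeal (Rb N) ↔ Ō.valuation (algebraMap (Rb N) κ r) < 1 := hSm
    let xR : (Rb N) := ⟨d, hd⟩
    have hxR0 : xR ≠ 0 := fun h => hd0 (congrArg Subtype.val h)
    have hxRm : xR ∈ maximalIdeal (Rb N) := (hSm xR).mpr hvd'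
    obtain ⟨uu, -, huuO, R', _, _, _, hinj, hR'O, hR'm, hlow, hup, d', z, α, u, hu, hdimR', hspan, hfact⟩ :=
      exists_localRing_monomial_of_embeddedResolution_dim (n := 1) (by norm_num) hEmb (R := (Rb N)) (K := κ) (E := κ)
        Subtype.val_injective hexcS hdimS Ō hRO hRm xR hxR0 hxRm
    let T : Subring κ := (Algebra.adjoin (Rb N) (uu : Set κ)).toSubring
    have hTO : T ≤ Ō.toSubring := fun w hw => huuO w hw
    have hST : (Rb N) ≤ T := fun w hw => (Algebra.adjoin (Rb N) (uu : Set κ)).algebraMap_mem (⟨w, hw⟩ : (Rb N))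
    have hTR : ∀ w ∈ T, w ∈ Set.range (algebraMap R' κ) := fun w hw => hlow w hw
    obtain ⟨R₂, hR₂def⟩ : ∃ R₂ : Subring κ, R₂ = locAtCentre T Ō := ⟨_, rfl⟩
    have hrange : (algebraMap R' κ).range = R₂ := by
      rw [hR₂def]; exact range_eq_locAtCentre (algebraMap R' κ) Ō T hTR hR'm hup
    obtain ⟨hreg₂, z₂, u₂, hz₂, hu₂K, hspan₂, hdim₂, hu₂⟩ :=
      regular_data_of_range_eq (algebraMap R' κ) hinj R₂ hrange z hspan hdimR' u hu
    haveI := hreg₂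
    have hTR₂ : T ≤ R₂ := by rw [hR₂def]; exact le_locAtCentre T Ō
    have hSR₂ : (Rb N) ≤ R₂ := hST.trans hTR₂
    have hR₂O : R₂ ≤ Ō.toSubring := by rw [hR₂def]; exact locAtCentre_le hTO
    -- `R₂` is a local blow-up of `(Rb N)`, hence the local ring of a finitely generated model: dimension 2
    have hlb : IsLocalBlowup Ō (Rb N) R₂ := by
      refine ⟨hSO, uu, fun w hw => huuO w (Algebra.subset_adjoin hw), ?_⟩
      rw [hR₂def]
      congr 1
      change (Algebra.adjoin (Rb N) (uu : Set κ)).toSubring = _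
      rw [Algebra.adjoin_eq_ring_closure]
      congr 1
      ext w
      simp only [Set.mem_union, Set.mem_range, SetLike.mem_coe]
      constructor
      · rintro (⟨r, rfl⟩ | hw)
        · exact Or.inl r.2
        · exact Or.inr hw
      · rintro (hw | hw)
        · exact Or.inl ⟨⟨w, hw⟩, rfl⟩
        · exact Or.inr hw
    have hlb' : IsLocalBlowup Ō (locAtCentre ĀN.toSubring Ō) R₂ := by rw [← hRN]; exact hlb
    obtain ⟨Ā', hĀ'O, hĀĀ', hĀ'fg, hR₂Ā'⟩ := exists_model_of_isLocalBlowup (A := Ā) (A₁ := ĀN) hĀĀN hĀNfg hlb'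
    have hdimR₂ : ringKrullDim R₂ = 2 := by
      rw [hR₂Ā', ringKrullDim_locAtCentre_eq_of_isMaximal Ā' hĀ'fg Ō hĀ'O (hzd _ hĀ'O (fun w hw => hĀĀ' hw)),
        ringKrullDim_eq_of_fg_of_le hĀfg hĀ'fg hĀĀ', hdimĀ]
    have hd'2 : d' = 2 := by
      have h := hdim₂; rw [hdimR₂] at h; exact_mod_cast h.symm
    subst hd'2
    -- Abhyankar: `R₂ = R̄_n` for some `n`
    have hdomR₂ : SubringDominates R₂ Ō.toSubring := by rw [hR₂def]; exact subringDominates_locAtCentre hTO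
    have hR0S : SubringDominates (Rb 0) R₂ :=
      (hdomseq 0).1.of_le_of_le ((hmono (Nat.zero_le N)).trans hSR₂) hR₂O
    haveI hreg0 := hregR 0
    have hof : IsLocalRingOf (Rb 0) := by rw [hR0]; exact isLocalRingOf_locAtCentre Ā Ō hĀŌ
    obtain ⟨n, hn⟩ := AbhyankarQuadraticFactorization_holds.exists_eq_of_dominated (R := Rb) (hregR 0) (hdimR 0) hof hstep
      hreg₂ hdimR₂ hR0S hdomR₂
    -- the stage `M := max n N` carries `R₂`
    have hM : Rb (max n N) = R₂ := by
      rcases le_total n N with hle | hle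
      · rw [max_eq_right hle]
        exact le_antisymm hSR₂ (hn ▸ hmono hle)
      · rw [max_eq_left hle, hn]
    -- read off, at the stage `M`
    obtain ⟨hregM, w₂, e₂, hw₂, he₂K, hspanM, -, he₂⟩ :=
      regular_data_of_range_eq (algebraMap R' κ) hinj (Rb (max n N)) (hrange.trans hM.symm) z hspan hdimR' u hu
    refine ⟨max n N, le_max_right _ _, w₂ 0, w₂ 1, e₂, α 0, α 1, he₂, ?_, ?_⟩
    · rw [← hspanM, ideal_span_range_fin_two]
    · have h4 : algebraMap R' κ (u * ∏ i, z i ^ α i) = (e₂ : κ) * ∏ i, (w₂ i : κ) ^ α i := by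
        rw [map_mul, map_prod, ← he₂K]
        simp_rw [map_pow, ← hw₂]
      have : d = algebraMap R' κ (u * ∏ i, z i ^ α i) := by rw [← hfact]; rfl
      rw [this, h4, Fin.prod_univ_two, mul_assoc]

end Summit.ResolutionOfSingularities.ResolutionOfSingularities.Theorems.RadicialJung.CleanModels

end
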